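import Literature.Geometry.Symplectic.GromovCompactnessSpheresProofs
import Literature.Topology.FourManifolds.ComplexProjectiveSpacePositiveAtlas
import Summits.SmoothPoincare4.SmoothPoincare4.Theorems.SymplecticOrigamiGromovRecognitionRelEndHelperTwoChartOfGlued
import Summits.SmoothPoincare4.SmoothPoincare4.Theorems.SymplecticOrigamiGromovRecognitionRelEndHelperJHolomorphicOfCompactOpenLimit

/-!
# Uniform limits of `J`-spheres are `J`-spheres
(registered helper `helper_uniformLimitIsJSphere` of line `cross-cap-laurent`, crux `GromovRecognitionRelEnd`,
item stmt-SmoothPoincare4-11009; it is VERBATIM the birth stub `stub_uniformLimitIsJSphere` of the split piece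
`GromovCompactnessSpheres`, child item stmt-SmoothPoincare4-16777 — McDuff–Salamon 2012 §4.6 / Hummel 1997
Ch. III Prop. 3.1: a uniform limit `F : ℂℙ¹ → X` of glued maps of `J`-holomorphic two-chart spheres is itself
the glued map of a smooth `J`-holomorphic two-chart sphere)

Proof (assembly).  Put `u z := F [1 : z]`, `v w := F [w : 1]` (the two affine charts of `ℂℙ¹`,
`z ↦ (affineChart 0)⁻¹ z`, `w ↦ (affineChart 1)⁻¹ w`).  The two-chart bookkeeping (`v z = u z⁻¹`, the
two chart identities, continuity) is `helper_twoChartOfGlued`.  The chart-`0` readings `Gs k ∘ [1 : ·]` of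
the approximating glued maps are the smooth `J`-holomorphic first charts `uₖ` of the approximating spheres,
and `Gs k → F` in `C(ℂℙ¹, X)` gives `uₖ → u` in the compact-open sense (precompose with the continuous chart
inverse; `ContinuousMap.tendsto_nhds_compactOpen`), so `u` is smooth and `J`-holomorphic by the manifold
Weierstraß theorem `helper_jHolomorphicOfCompactOpenLimit` (Hummel 1997 III.3.1 over the tree's proved flat
theorem `JHolomorphicWeierstrassR4_holds`); likewise `v`.  The taming form and the homotopy hypothesis are not
needed for this closedness statement.

References: C. Hummel, *Gromov's Compactness Theorem for Pseudo-holomorphic Curves* (1997), Ch. III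
Prop. 3.1; D. McDuff, D. Salamon, *J-holomorphic curves and symplectic topology*, 2nd ed. (2012),
Thm. 4.1.1, §4.6, Thm. B.4.2.  No new definitions, notation or instances.
-/

noncomputable section

open scoped Manifold ContDiff Topology
open Set Function Filter
open Literature.Topology.FourManifolds Literature.Topology.FourManifolds.ComplexProjectiveSpace
open Literature.Geometry.Symplectic Literature.Geometry.Kaehler

-- the prescribed namespace `Summit.<P>.<Sub>.…` duplicates `SmoothPoincare4` (P = Sub)
set_option linter.dupNamespace false

namespace Summit.SmoothPoincare4.SmoothPoincare4.Theorems.GromovRecognitionRelEnd.CrossCapLaurent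

namespace UniformLimitSphere

/-- The affine chart inverses `z ↦ (affineChart i)⁻¹ z` of `ℂℙ¹` (`[1 : z]`, `[w : 1]`) are continuous
(inverse of an atlas member after a continuous linear map; cf. `contMDiff_sigma`). [folklore] -/
theorem continuous_chartSymm (i : Fin (1 + 1)) :
    Continuous (fun z : ℂ => (affineChart (n := 1) i).symm (realCoordinates 1 fun _ : Fin 1 => z)) := by
  have h1 : ContinuousOn (affineChart (n := 1) i).symm univ := fun x _ =>
    (affineChart (n := 1) i).continuousOn_symm x (mem_univ x)
  have h2 : Continuous (fun z : ℂ => realCoordinates 1 (fun _ : Fin 1 => z)) :=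
    (realCoordinates 1).continuous.comp (continuous_pi fun _ => continuous_id)
  exact (continuousOn_univ.1 h1).comp h2

/-- **Compact-open convergence of glued maps, read in an affine chart.** If `Gs k → F` in
`C(ℂℙ¹, X)` and `us k z = Gs k ((affineChart i)⁻¹ z)`, then `us k → F ∘ (affineChart i)⁻¹` in the raw
compact-open sense (every compact `K` and open `O ⊇ F((affineChart i)⁻¹ K)`: eventually `us k` maps `K`
into `O`). [folklore] -/
theorem compactOpen_chart {X : Type} [TopologicalSpace X] {Gs : ℕ → C(ComplexProjectiveSpace 1, X)}
    {F : C(ComplexProjectiveSpace 1, X)} (hlim : Tendsto Gs atTop (𝓝 F)) (i : Fin (1 + 1))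
    {us : ℕ → ℂ → X}
    (hus : ∀ k z, us k z = Gs k ((affineChart (n := 1) i).symm (realCoordinates 1 fun _ : Fin 1 => z))) :
    ∀ K : Set ℂ, IsCompact K → ∀ O : Set X, IsOpen O →
      MapsTo (fun z : ℂ => F ((affineChart (n := 1) i).symm (realCoordinates 1 fun _ : Fin 1 => z))) K O →
        ∀ᶠ k in atTop, MapsTo (us k) K O := by
  intro K hK O hO hmaps
  have hK' : IsCompact ((fun z : ℂ => (affineChart (n := 1) i).symm
      (realCoordinates 1 fun _ : Fin 1 => z)) '' K) := hK.image (continuous_chartSymm i)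
  have hmaps' : MapsTo F ((fun z : ℂ => (affineChart (n := 1) i).symm
      (realCoordinates 1 fun _ : Fin 1 => z)) '' K) O := by
    rintro _ ⟨z, hz, rfl⟩
    exact hmaps hz
  filter_upwards [ContinuousMap.tendsto_nhds_compactOpen.1 hlim _ hK' O hO hmaps'] with k hk z hz
  rw [hus k z]
  exact hk (mem_image_of_mem _ hz)

end UniformLimitSphere

open UniformLimitSphere in
/-- **Uniform limits of `J`-spheres are `J`-spheres, from the two registered helpers** (assembly of
`helper_uniformLimitIsJSphere` from `helper_twoChartOfGlued` and `helper_jHolomorphicOfCompactOpenLimit`,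
both taken here as hypotheses `hTC`, `hWL`). [cite: Hummel1997, Ch. III Prop. 3.1] -/
theorem uniformLimitIsJSphere_of
    (hTC : ∀ (X : Type) [TopologicalSpace X] (F : C(Literature.Topology.FourManifolds.ComplexProjectiveSpace 1, X)), (∀ z : ℂ, z ≠ 0 → F ((Literature.Topology.FourManifolds.ComplexProjectiveSpace.affineChart (n := 1) 1).symm (Literature.Topology.FourManifolds.ComplexProjectiveSpace.realCoordinates 1 fun _ => z)) = F ((Literature.Topology.FourManifolds.ComplexProjectiveSpace.affineChart (n := 1) 0).symm (Literature.Topology.FourManifolds.ComplexProjectiveSpace.realCoordinates 1 fun _ => z⁻¹))) ∧ (∀ p, Literature.Topology.FourManifolds.ComplexProjectiveSpace.CoordNeZero 0 p → F p = F ((Literature.Topology.FourManifolds.ComplexProjectiveSpace.affineChart (n := 1) 0).symm (Literature.Topology.FourManifolds.ComplexProjectiveSpace.realCoordinates 1 fun _ => Literature.Topology.FourManifolds.ComplexProjectiveSpace.affineCoordComplex 0 p 0))) ∧ (∀ p, Literature.Topology.FourManifolds.ComplexProjectiveSpace.CoordNeZero 1 p → F p = F ((Literature.Topology.FourManifolds.ComplexProjectiveSpace.affineChart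 (n := 1) 1).symm (Literature.Topology.FourManifolds.ComplexProjectiveSpace.realCoordinates 1 fun _ => Literature.Topology.FourManifolds.ComplexProjectiveSpace.affineCoordComplex 1 p 0))) ∧ Continuous (fun z : ℂ => F ((Literature.Topology.FourManifolds.ComplexProjectiveSpace.affineChart (n := 1) 0).symm (Literature.Topology.FourManifolds.ComplexProjectiveSpace.realCoordinates 1 fun _ => z))) ∧ Continuous (fun w : ℂ => F ((Literature.Topology.FourManifolds.ComplexProjectiveSpace.affineChart (n := 1) 1).symm (Literature.Topology.FourManifolds.ComplexProjectiveSpace.realCoordinates 1 fun _ => w))))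
    (hWL : ∀ (X : Type) [TopologicalSpace X] [T2Space X] [SecondCountableTopology X] [ChartedSpace (EuclideanSpace ℝ (Fin 4)) X] [IsManifold (𝓡 4) ∞ X] (JX : Literature.Geometry.Symplectic.AlmostComplexStructure (𝓡 4) ∞ X) (us : ℕ → ℂ → X) (u : ℂ → X), (∀ k, ContMDiff 𝓘(ℝ, ℂ) (𝓡 4) ∞ (us k)) → (∀ k, Literature.Geometry.Symplectic.IsJHolomorphic (𝓡 4) (fun y => JX y) (us k)) → Continuous u → (∀ K : Set ℂ, IsCompact K → ∀ O : Set X, IsOpen O → Set.MapsTo u K O → ∀ᶠ k in Filter.atTop, Set.MapsTo (us k) K O) → ContMDiff 𝓘(ℝ, ℂ) (𝓡 4) ∞ u ∧ Literature.Geometry.Symplectic.IsJHolomorphic (𝓡 4) (fun y => JX y) u) :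
    ∀ (X : Type) [TopologicalSpace X] [T2Space X] [SecondCountableTopology X] [CompactSpace X] [ChartedSpace (EuclideanSpace ℝ (Fin 4)) X] [IsManifold (𝓡 4) ∞ X] (ωX : Literature.Geometry.Kaehler.MForm (𝓡 4) X ℝ 2) (JX : Literature.Geometry.Symplectic.AlmostComplexStructure (𝓡 4) ∞ X) (Gs : ℕ → C(Literature.Topology.FourManifolds.ComplexProjectiveSpace 1, X)) (F₀ F : C(Literature.Topology.FourManifolds.ComplexProjectiveSpace 1, X)), Literature.Geometry.Kaehler.IsSmoothForm ωX → Literature.Geometry.Kaehler.IsClosedForm ωX → JX.IsTamedBy ωX → (∀ k, (∃ (u v : ℂ → X), ContMDiff 𝓘(ℝ, ℂ) (𝓡 4) ∞ u ∧ ContMDiff 𝓘(ℝ, ℂ) (𝓡 4) ∞ v ∧ (∀ z : ℂ, z ≠ 0 → v z = u z⁻¹) ∧ Literature.Geometry.Symplectic.IsJHolomorphic (𝓡 4) (fun y => JX y) u ∧ Literature.Geometry.Symplectic.IsJHolomorphic (𝓡 4) (fun y => JX y) v ∧ (∀ p, Literature.Topology.FourManifolds.ComplexProjectiveSpace.CoordNeZero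 0 p → Gs k p = u (Literature.Topology.FourManifolds.ComplexProjectiveSpace.affineCoordComplex 0 p 0)) ∧ (∀ p, Literature.Topology.FourManifolds.ComplexProjectiveSpace.CoordNeZero 1 p → Gs k p = v (Literature.Topology.FourManifolds.ComplexProjectiveSpace.affineCoordComplex 1 p 0))) ∧ (Gs k).Homotopic F₀) → Filter.Tendsto Gs Filter.atTop (𝓝 F) → ∃ (u v : ℂ → X), ContMDiff 𝓘(ℝ, ℂ) (𝓡 4) ∞ u ∧ ContMDiff 𝓘(ℝ, ℂ) (𝓡 4) ∞ v ∧ (∀ z : ℂ, z ≠ 0 → v z = u z⁻¹) ∧ Literature.Geometry.Symplectic.IsJHolomorphic (𝓡 4) (fun y => JX y) u ∧ Literature.Geometry.Symplectic.IsJHolomorphic (𝓡 4) (fun y => JX y) v ∧ (∀ p, Literature.Topology.FourManifolds.ComplexProjectiveSpace.CoordNeZero 0 p → F p = u (Literature.Topology.FourManifolds.ComplexProjectiveSpace.affineCoordComplex 0 p 0)) ∧ (∀ p, Literature.Topology.FourManifolds.ComplexProjectiveSpace.CoordNeZero 1 p → F p = v (Literature.Topology.FourManifolds.ComplexProjectiveSpace.affineCoordComplex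 1 p 0)) := by
  intro X _ _ _ _ _ _ ωX JX Gs F₀ F _ _ _ hyp hlim
  -- the two charts of the limit
  set u : ℂ → X := fun z => F ((affineChart (n := 1) 0).symm (realCoordinates 1 fun _ : Fin 1 => z))
    with hu_def
  set v : ℂ → X := fun w => F ((affineChart (n := 1) 1).symm (realCoordinates 1 fun _ : Fin 1 => w))
    with hv_def
  obtain ⟨hvu, hF0, hF1, hcu, hcv⟩ := hTC X F
  -- the two charts of the approximating spheres
  have hyp' := fun k => (hyp k).1
  choose us vs hus hvs _huv hJus hJvs hG0 hG1 using hyp'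
  -- they are the chart readings of the glued maps
  have hus_eq : ∀ k z, us k z =
      Gs k ((affineChart (n := 1) 0).symm (realCoordinates 1 fun _ : Fin 1 => z)) := fun k z => by
    rw [hG0 k _ (coordNeZero_affineChart_symm 0 _), affineCoordComplex_affineChart_symm]
  have hvs_eq : ∀ k w, vs k w =
      Gs k ((affineChart (n := 1) 1).symm (realCoordinates 1 fun _ : Fin 1 => w)) := fun k w => by
    rw [hG1 k _ (coordNeZero_affineChart_symm 1 _), affineCoordComplex_affineChart_symm]
  -- the manifold Weierstraß theorem in each chart
  obtain ⟨hu, hJu⟩ := hWL X JX us u hus hJus hcu (compactOpen_chart hlim 0 hus_eq)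
  obtain ⟨hv, hJv⟩ := hWL X JX vs v hvs hJvs hcv (compactOpen_chart hlim 1 hvs_eq)
  exact ⟨u, v, hu, hv, hvu, hJu, hJv, hF0, hF1⟩

/-- **Registered helper `helper_uniformLimitIsJSphere` = the birth stub `stub_uniformLimitIsJSphere` of the
split piece `GromovCompactnessSpheres` (child item stmt-SmoothPoincare4-16777), verbatim:** a uniform limit
`F : C(ℂℙ¹, X)` of glued maps of smooth `J`-holomorphic two-chart spheres (in a compact `4`-manifold with a
closed taming form; these hypotheses and the homotopy class are not used) is the glued map of a smooth
`J`-holomorphic two-chart sphere — `uniformLimitIsJSphere_of` fed with the landed helpers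
`helper_twoChartOfGlued` and `helper_jHolomorphicOfCompactOpenLimit`. [cite: Hummel1997, Ch. III Prop. 3.1] -/
theorem helper_uniformLimitIsJSphere : ∀ (X : Type) [TopologicalSpace X] [T2Space X] [SecondCountableTopology X] [CompactSpace X] [ChartedSpace (EuclideanSpace ℝ (Fin 4)) X] [IsManifold (𝓡 4) ∞ X] (ωX : Literature.Geometry.Kaehler.MForm (𝓡 4) X ℝ 2) (JX : Literature.Geometry.Symplectic.AlmostComplexStructure (𝓡 4) ∞ X) (Gs : ℕ → C(Literature.Topology.FourManifolds.ComplexProjectiveSpace 1, X)) (F₀ F : C(Literature.Topology.FourManifolds.ComplexProjectiveSpace 1, X)), Literature.Geometry.Kaehler.IsSmoothForm ωX → Literature.Geometry.Kaehler.IsClosedForm ωX → JX.IsTamedBy ωX → (∀ k, (∃ (u v : ℂ → X), ContMDiff 𝓘(ℝ, ℂ) (𝓡 4) ∞ u ∧ ContMDiff 𝓘(ℝ, ℂ) (𝓡 4) ∞ v ∧ (∀ z : ℂ, z ≠ 0 → v z = u z⁻¹) ∧ Literature.Geometry.Symplectic.IsJHolomorphic (𝓡 4) (fun y => JX y) u ∧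 Literature.Geometry.Symplectic.IsJHolomorphic (𝓡 4) (fun y => JX y) v ∧ (∀ p, Literature.Topology.FourManifolds.ComplexProjectiveSpace.CoordNeZero 0 p → Gs k p = u (Literature.Topology.FourManifolds.ComplexProjectiveSpace.affineCoordComplex 0 p 0)) ∧ (∀ p, Literature.Topology.FourManifolds.ComplexProjectiveSpace.CoordNeZero 1 p → Gs k p = v (Literature.Topology.FourManifolds.ComplexProjectiveSpace.affineCoordComplex 1 p 0))) ∧ (Gs k).Homotopic F₀) → Filter.Tendsto Gs Filter.atTop (𝓝 F) → ∃ (u v : ℂ → X), ContMDiff 𝓘(ℝ, ℂ) (𝓡 4) ∞ u ∧ ContMDiff 𝓘(ℝ, ℂ) (𝓡 4) ∞ v ∧ (∀ z : ℂ, z ≠ 0 → v z = u z⁻¹) ∧ Literature.Geometry.Symplectic.IsJHolomorphic (𝓡 4) (fun y => JX y) u ∧ Literature.Geometry.Symplectic.IsJHolomorphic (𝓡 4) (fun y => JX y) v ∧ (∀ p, Literature.Topology.FourManifolds.ComplexProjectiveSpace.CoordNeZero 0 p → F p = u (Literature.Topology.FourManifolds.ComplexProjectiveSpace.affineCoordComplex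 0 p 0)) ∧ (∀ p, Literature.Topology.FourManifolds.ComplexProjectiveSpace.CoordNeZero 1 p → F p = v (Literature.Topology.FourManifolds.ComplexProjectiveSpace.affineCoordComplex 1 p 0)) :=
  uniformLimitIsJSphere_of helper_twoChartOfGlued helper_jHolomorphicOfCompactOpenLimit

end Summit.SmoothPoincare4.SmoothPoincare4.Theorems.GromovRecognitionRelEnd.CrossCapLaurent

end
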